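import Literature.NumberTheory.Automorphic.TwistedQuotientInducedInvariants
import Literature.Algebra.Homology.GroupCohomologySemilinearBijective
import HarnessLib

/-!
# Change of coefficient ring for `W^{L/L'}` along a bijective semilinear map of the values

Topic `NumberTheory/Automorphic`; namespace `Literature.NumberTheory.Automorphic.TwistedQuotient`.
Definitions with bodies and theorems; no named fact, no instance, no `sorry`.

The Hochschild–Serre nilpotence (`TameLevel.pow_succ_map_φZ_heckePolyTower_eq_zero_of_heckeOperator`)
is available for `W = Fun(𝒢 ⧸ L', N')` with `N'` a finite free `ℤ/p^s`-module, over the ring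
`ℤ/p^s`, whereas the reduction of the integral structure produces `Fun(𝒢 ⧸ L', M/p^s)` over `ℤ_p`
(or `𝒪`).  The two are related by a bijective `τ`-SEMILINEAR map of the values (`τ : ℤ_p → ℤ/p^s`,
`e : M/p^s ≃ (ℤ/p^s)^d`).  Here, for a ring map `τ : k → k'`, representations `σ`, `σ'` of
`L ⧸ L'` on `N`, `N'` and an equivariant `e : N →ₛₗ[τ] N'`:

* `oneProdTwist σ = W = Fun(𝒢 ⧸ L', N)` with `Γ` acting by left translation and `L ⧸ L'` by
  `σ`-twisted right translation (`levelProdTwist` with `ρ = 1`), and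
  `transportRep e σ` — the representation `e ∘ σ ∘ e⁻¹` on `N'` for a bijective `e`
  (`τ` surjective);
* `hKerSemimap e : W^{L/L'} →ₛₗ[τ] W'^{L/L'}` (postcomposition on the values), `Γ`-equivariant,
  bijective when `e` is (`hKerSemimap_bijective`), and intertwining the Hecke polynomials
  `φZ (heckePolyTwist Q) 0` (`hKerSemimap_φZ_heckePolyTwist`);
* **`pow_map_φZ_eq_zero_of_semilinear`** — if `φZ (heckePolyTwist Q) 0` acts on
  `H^q(Γ, W'^{L/L'})` (over `k'`) with vanishing `m`-th power, then so it does on `H^q(Γ, W^{L/L'})`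
  (over `k`): the comparison `Hⁿ(s)` of `GroupCohomologySemilinearBijective` is injective.

## References

* P. Scholze, *On torsion in the cohomology of locally symmetric varieties*, Ann. of Math. 182
  (2015), §V.4, proof of Thm. V.4.1. [Scholze2015]
* K. S. Brown, *Cohomology of Groups*, GTM 87 (1982), III.1 Example 3. [Brown1982CohomologyGroups]
-/

noncomputable section

open CategoryTheory Literature.Algebra.Homology
open scoped Classical

universe u

namespace Literature.NumberTheory.Automorphic

namespace TwistedQuotient

variable {k k' : Type u} [CommRing k] [CommRing k'] {τ : k →+* k'} {Γ 𝒢 : Type u} [Group Γ]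
  [Group 𝒢] (ι : Γ →* 𝒢) {L' L : Subgroup 𝒢} (hle : L' ≤ L) [hN : (L'.subgroupOf L).Normal]
  {N : Type u} [AddCommGroup N] [Module k N] {N' : Type u} [AddCommGroup N'] [Module k' N']
  (σ : Representation k (L ⧸ L'.subgroupOf L) N) (σ' : Representation k' (L ⧸ L'.subgroupOf L) N')

/-! ### `W` with untwisted `Γ`-action -/

/-- The trivial `Γ`-action commutes with `σ`. [folklore] -/
theorem commute_one (γ : Γ) (h : L ⧸ L'.subgroupOf L) :
    Commute ((1 : Representation k Γ N) γ) (σ h) :=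
  Commute.one_left _

/-- `W = Fun(𝒢 ⧸ L', N)`: `Γ` by left translation, `L ⧸ L'` by `σ`-twisted right translation.
[cite: Scholze2015, §V.4 (proof of Thm. V.4.1)] -/
abbrev oneProdTwist : Rep k (Γ × (L ⧸ L'.subgroupOf L)) :=
  levelProdTwist ι hle (1 : Representation k Γ N) σ (commute_one σ)

/-- The `Γ`-action on `W^{L/L'}` is left translation of the values. [folklore] -/
theorem val_ρ_hKerRep_oneProdTwist (γ : Γ) (f : hKerRep (oneProdTwist ι hle σ) 0)
    (x : Fin 0 → L ⧸ L'.subgroupOf L) (c : 𝒢 ⧸ L') :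
    ((hKerRep (oneProdTwist ι hle σ) 0).ρ γ f).1 x c = f.1 x ((ι γ)⁻¹ • c) := by
  change (levelProdTwistRep ι hle (1 : Representation k Γ N) σ (commute_one σ)
    (MonoidHom.inl _ _ γ)) (f.1 x) c = _
  rw [levelProdTwistRep_inl, coeffRepresentation_apply]
  rfl

/-! ### Transport of a representation along a bijective semilinear map -/

section Transport

variable (e : N →ₛₗ[τ] N') (hbij : Function.Bijective e) {Q : Type*} [Group Q]
  (σ₀ : Representation k Q N)

/-- The additive equivalence underlying a bijective semilinear map. [folklore] -/
def addEquivOfBijective : N ≃+ N' :=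
  AddEquiv.ofBijective e.toAddMonoidHom hbij

/-- Unfolding lemma. [folklore] -/
@[simp]
theorem addEquivOfBijective_apply (v : N) : addEquivOfBijective e hbij v = e v :=
  rfl

/-- `e (e⁻¹ w) = w`. [folklore] -/
@[simp]
theorem apply_addEquivOfBijective_symm (w : N') : e ((addEquivOfBijective e hbij).symm w) = w :=
  (addEquivOfBijective e hbij).apply_symm_apply w

variable [RingHomSurjective τ]

/-- **Transport `e ∘ σ₀(h) ∘ e⁻¹`** of a representation along a bijective `τ`-semilinear `e`
(`τ` surjective, so the transport is `k'`-linear). [folklore] -/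
def transportRep : Representation k' Q N' where
  toFun h :=
    { toFun := fun w => e (σ₀ h ((addEquivOfBijective e hbij).symm w))
      map_add' := fun w w' => by rw [map_add, map_add, map_add]
      map_smul' := fun c w => by
        obtain ⟨a, rfl⟩ := RingHomSurjective.is_surjective (σ := τ) c
        have h1 : (addEquivOfBijective e hbij).symm (τ a • w) =
            a • (addEquivOfBijective e hbij).symm w := by
          apply (addEquivOfBijective e hbij).injective
          rw [AddEquiv.apply_symm_apply, addEquivOfBijective_apply, map_smulₛₗ,
            apply_addEquivOfBijective_symm]
        rw [h1, map_smul, map_smulₛₗ, RingHom.id_apply] }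
  map_one' := LinearMap.ext fun w => by simp
  map_mul' h h' := LinearMap.ext fun w => by
    change e (σ₀ (h * h') _) = e (σ₀ h ((addEquivOfBijective e hbij).symm (e (σ₀ h' _))))
    rw [map_mul, Module.End.mul_apply, ← addEquivOfBijective_apply e hbij (σ₀ h' _),
      AddEquiv.symm_apply_apply]

/-- Unfolding lemma for `transportRep`. [folklore] -/
theorem transportRep_apply (h : Q) (w : N') :
    transportRep e hbij σ₀ h w = e (σ₀ h ((addEquivOfBijective e hbij).symm w)) :=
  rfl

/-- **`e` intertwines `σ₀` and its transport.** [folklore] -/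
theorem transportRep_apply_apply (h : Q) (v : N) : e (σ₀ h v) = transportRep e hbij σ₀ h (e v) := by
  rw [transportRep_apply, ← addEquivOfBijective_apply e hbij v, AddEquiv.symm_apply_apply]

end Transport

/-! ### The semilinear comparison map on `W^{L/L'}` -/

variable (e : N →ₛₗ[τ] N') (he : ∀ (h : L ⧸ L'.subgroupOf L) (v : N), e (σ h v) = σ' h (e v))

/-- Postcomposition with `e` on functions. [folklore] -/
def valSemimap : ((𝒢 ⧸ L') → N) →ₛₗ[τ] ((𝒢 ⧸ L') → N') where
  toFun g := fun c => e (g c)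
  map_add' g g' := funext fun c => map_add e (g c) (g' c)
  map_smul' a g := funext fun c => map_smulₛₗ e a (g c)

/-- Unfolding lemma. [folklore] -/
@[simp]
theorem valSemimap_apply (g : (𝒢 ⧸ L') → N) (c : 𝒢 ⧸ L') : valSemimap (L' := L') e g c = e (g c) :=
  rfl

include he in
/-- **The comparison `W^{L/L'} → W'^{L/L'}`**, `f ↦ e ∘ f`, a `τ`-semilinear map.
[cite: Brown1982CohomologyGroups, III.1 Example 3] -/
def hKerSemimap : hKerRep (oneProdTwist ι hle σ) 0 →ₛₗ[τ] hKerRep (oneProdTwist ι hle σ') 0 where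
  toFun f := ⟨fun x => valSemimap e (f.1 x),
    (mem_hKer_levelProdTwist_iff ι hle (1 : Representation k' Γ N') σ' (commute_one σ') _).2
      fun x h c => by
        rw [valSemimap_apply, valSemimap_apply, ← he,
          (mem_hKer_levelProdTwist_iff ι hle (1 : Representation k Γ N) σ (commute_one σ) _).1 f.2]⟩
  map_add' f f' := Subtype.ext (funext fun x => map_add (valSemimap (L' := L') e) (f.1 x) (f'.1 x))
  map_smul' a f := Subtype.ext (funext fun x => map_smulₛₗ (valSemimap (L' := L') e) a (f.1 x))

/-- Unfolding lemma for `hKerSemimap`. [folklore] -/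
@[simp]
theorem val_hKerSemimap (f : hKerRep (oneProdTwist ι hle σ) 0) (x : Fin 0 → L ⧸ L'.subgroupOf L)
    (c : 𝒢 ⧸ L') : (hKerSemimap ι hle σ σ' e he f).1 x c = e (f.1 x c) :=
  rfl

/-- `hKerSemimap` is `Γ`-equivariant. [folklore] -/
theorem hKerSemimap_equivariant (γ : Γ) (f : hKerRep (oneProdTwist ι hle σ) 0) :
    hKerSemimap ι hle σ σ' e he ((hKerRep (oneProdTwist ι hle σ) 0).ρ γ f) =
      (hKerRep (oneProdTwist ι hle σ') 0).ρ γ (hKerSemimap ι hle σ σ' e he f) := by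
  refine Subtype.ext (funext fun x => funext fun c => ?_)
  rw [val_hKerSemimap, val_ρ_hKerRep_oneProdTwist, val_ρ_hKerRep_oneProdTwist, val_hKerSemimap]

/-- `hKerSemimap` is injective when `e` is. [folklore] -/
theorem hKerSemimap_injective (hinj : Function.Injective e) :
    Function.Injective (hKerSemimap ι hle σ σ' e he) := fun f f' h =>
  Subtype.ext (funext fun x => funext fun c => hinj (by
    rw [← val_hKerSemimap ι hle σ σ' e he f x c, h, val_hKerSemimap]))

/-- `hKerSemimap` is surjective when `e` is bijective. [folklore] -/
theorem hKerSemimap_surjective (hbij : Function.Bijective e) :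
    Function.Surjective (hKerSemimap ι hle σ σ' e he) := by
  intro f'
  let E := AddEquiv.ofBijective e.toAddMonoidHom hbij
  have hE : ∀ v, E v = e v := fun v => rfl
  refine ⟨⟨fun x c => E.symm (f'.1 x c),
    (mem_hKer_levelProdTwist_iff ι hle (1 : Representation k Γ N) σ (commute_one σ) _).2
      fun x h c => ?_⟩, ?_⟩
  · apply hbij.1
    rw [he, ← hE, ← hE, E.apply_symm_apply, E.apply_symm_apply]
    exact (mem_hKer_levelProdTwist_iff ι hle (1 : Representation k' Γ N') σ' (commute_one σ') _).1
      f'.2 x h c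
  · refine Subtype.ext (funext fun x => funext fun c => ?_)
    rw [val_hKerSemimap]
    exact E.apply_symm_apply _

/-- **`hKerSemimap` is bijective when `e` is.** [cite: Brown1982CohomologyGroups, III.1 Example 3] -/
theorem hKerSemimap_bijective (hbij : Function.Bijective e) :
    Function.Bijective (hKerSemimap ι hle σ σ' e he) :=
  ⟨hKerSemimap_injective ι hle σ σ' e he hbij.1, hKerSemimap_surjective ι hle σ σ' e he hbij⟩

/-! ### Compatibility with the Hecke polynomials -/

/-- `T_g (e ∘ f) = e ∘ T_g f` for an additive (semilinear) map `e` of the values. [folklore] -/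
theorem heckeFun_valSemimap (g₀ : 𝒢) (f : (𝒢 ⧸ L') → N) :
    ArithmeticQuotient.heckeFun k' L' g₀ N' (valSemimap e f) =
      valSemimap (L' := L') e (ArithmeticQuotient.heckeFun k L' g₀ N f) := by
  funext c
  rw [ArithmeticQuotient.heckeFun_apply, valSemimap_apply, ArithmeticQuotient.heckeFun_apply]
  split_ifs with h
  · rw [map_sum]
    rfl
  · exact (map_zero e).symm

variable {I : Type*} (t : I → 𝒢)
  (hconjₜ : ∀ (i : I) (l : L), ∃ a ∈ L', ∃ b ∈ L', (l : 𝒢) * t i * (l : 𝒢)⁻¹ = a * t i * b)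
  (hfinₜ : ∀ i : I, (ArithmeticQuotient.doubleCosetQuot L' (t i)).Finite)

/-- **`hKerSemimap` intertwines the Hecke polynomials** `φZ (heckePolyTwist Q) 0` on `W^{L/L'}`
and `W'^{L/L'}`. [cite: Scholze2015, §V.4 (proof of Thm. V.4.1)] -/
theorem hKerSemimap_φZ_heckePolyTwist (Q : FreeRing I) (f : hKerRep (oneProdTwist ι hle σ) 0) :
    hKerSemimap ι hle σ σ' e he
        ((φZ (oneProdTwist ι hle σ) (heckePolyTwist ι hle (1 : Representation k Γ N) σ
          (commute_one σ) t hconjₜ hfinₜ Q) 0).hom f) =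
      (φZ (oneProdTwist ι hle σ') (heckePolyTwist ι hle (1 : Representation k' Γ N') σ'
          (commute_one σ') t hconjₜ hfinₜ Q) 0).hom (hKerSemimap ι hle σ σ' e he f) := by
  induction Q using FreeRing.induction_on generalizing f with
  | hn1 =>
    rw [map_neg, map_one, map_neg, map_one]
    refine Subtype.ext (funext fun x => funext fun c => ?_)
    change e (-(f.1 x c)) = -(e (f.1 x c))
    rw [map_neg]
  | hb i =>
    rw [heckePolyTwist_of, heckePolyTwist_of]
    refine Subtype.ext (funext fun x => ?_)
    change valSemimap e (ArithmeticQuotient.heckeFun k L' (t i) N (f.1 x)) =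
      ArithmeticQuotient.heckeFun k' L' (t i) N' (valSemimap e (f.1 x))
    rw [heckeFun_valSemimap]
  | ha Q₁ Q₂ h₁ h₂ =>
    rw [map_add, map_add]
    refine Subtype.ext (funext fun x => funext fun c => ?_)
    have h₁' := congrFun (congrFun (congrArg Subtype.val (h₁ f)) x) c
    have h₂' := congrFun (congrFun (congrArg Subtype.val (h₂ f)) x) c
    change e (_ + _) = _ + _
    rw [map_add]
    exact congrArg₂ (· + ·) h₁' h₂'
  | hm Q₁ Q₂ h₁ h₂ =>
    rw [map_mul, map_mul]
    change hKerSemimap ι hle σ σ' e he ((φZ _ (heckePolyTwist ι hle 1 σ _ t hconjₜ hfinₜ Q₁) 0).hom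
      ((φZ _ (heckePolyTwist ι hle 1 σ _ t hconjₜ hfinₜ Q₂) 0).hom f)) =
      (φZ _ (heckePolyTwist ι hle 1 σ' _ t hconjₜ hfinₜ Q₁) 0).hom
        ((φZ _ (heckePolyTwist ι hle 1 σ' _ t hconjₜ hfinₜ Q₂) 0).hom (hKerSemimap ι hle σ σ' e he f))
    rw [h₁, h₂]

/-! ### Transfer of the nilpotence to the `k`-side -/

include he in
/-- **Nilpotence transfers along the semilinear comparison**: if `φZ (heckePolyTwist Q) 0` acts on
`H^q(Γ, W'^{L/L'})` with vanishing `m`-th power and `e` is bijective, then it acts on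
`H^q(Γ, W^{L/L'})` with vanishing `m`-th power (`Hⁿ` of the comparison is injective and
equivariant). [cite: Scholze2015, §V.4 (proof of Thm. V.4.1)]
[cite: Brown1982CohomologyGroups, III.1 Example 3] -/
theorem pow_map_φZ_eq_zero_of_semilinear (hbij : Function.Bijective e) (Q : FreeRing I)
    (q m : ℕ)
    (hQ' : (groupCohomology.map (A := hKerRep (oneProdTwist ι hle σ') 0) (MonoidHom.id Γ)
      (φZ (oneProdTwist ι hle σ')
        (heckePolyTwist ι hle (1 : Representation k' Γ N') σ' (commute_one σ') t hconjₜ hfinₜ Q)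
        0) q).hom ^ m = 0) :
    (groupCohomology.map (A := hKerRep (oneProdTwist ι hle σ) 0) (MonoidHom.id Γ)
      (φZ (oneProdTwist ι hle σ)
        (heckePolyTwist ι hle (1 : Representation k Γ N) σ (commute_one σ) t hconjₜ hfinₜ Q)
        0) q).hom ^ m = 0 := by
  set φ := φZ (oneProdTwist ι hle σ)
    (heckePolyTwist ι hle (1 : Representation k Γ N) σ (commute_one σ) t hconjₜ hfinₜ Q) 0
  set ψ := φZ (oneProdTwist ι hle σ')
    (heckePolyTwist ι hle (1 : Representation k' Γ N') σ' (commute_one σ') t hconjₜ hfinₜ Q) 0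
  set s := hKerSemimap ι hle σ σ' e he
  have hs : ∀ (γ : Γ) (a : (hKerRep (oneProdTwist ι hle σ) 0).V),
      s ((hKerRep (oneProdTwist ι hle σ) 0).ρ γ a) = (hKerRep (oneProdTwist ι hle σ') 0).ρ γ (s a) :=
    hKerSemimap_equivariant ι hle σ σ' e he
  set S := semimap s hs q
  set Z := (groupCohomology.map (A := hKerRep (oneProdTwist ι hle σ) 0) (MonoidHom.id Γ) φ q).hom
  set Z' := (groupCohomology.map (A := hKerRep (oneProdTwist ι hle σ') 0) (MonoidHom.id Γ) ψ q).hom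
  have hnat : ∀ x, S (Z x) = Z' (S x) := fun x =>
    semimap_map_endo s hs φ ψ (hKerSemimap_φZ_heckePolyTwist ι hle σ σ' e he t hconjₜ hfinₜ Q) q x
  have hpow : ∀ (j : ℕ) (x), S ((Z ^ j) x) = (Z' ^ j) (S x) := by
    intro j
    induction j with
    | zero => intro x; simp
    | succ j ih =>
      intro x
      rw [pow_succ, pow_succ, Module.End.mul_apply, Module.End.mul_apply, ih (Z x), hnat]
  have hS : Function.Injective S :=
    semimap_injective_of_bijective s hs (hKerSemimap_bijective ι hle σ σ' e he hbij) q
  refine LinearMap.ext fun x => hS ?_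
  rw [hpow, hQ', LinearMap.zero_apply, LinearMap.zero_apply]
  exact (map_zero S).symm

end TwistedQuotient

end Literature.NumberTheory.Automorphic
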